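import Summits.QuantumAdvantage.QuantumAdvantage.Theorems.SosSandwichPseudoBoundedAAClassicalCornerBlockCalculus
import HarnessLib

/-!
# Crux `PseudoBoundedAA` (stmt-QuantumAdvantage-15237, route SosSandwich) — GATED TREES on `{0,1}^{m+(n₁+n₂)}`:
# evaluation and queries of `query (castAdd σ) (T₂ on the right inner block) (T₁ on the left inner block)`

Support file (`--supports stmt-QuantumAdvantage-15237`, def-free), sequel of `…ClassicalCornerBlockCalculus` and
`…ClassicalCornerGatedComposition`.  The members of the gated-composition (soft-address) family for the census's `L²`-OSSS
question (`C₀ ≥ 6/5, 32/27, …, ≈ 1.67`, hands' evidence SOFT-ADDRESS-RECURSION-15237.md) are mixtures of GATED TREES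

  `gated σ T₁ T₂ := query (castAdd (n₁+n₂) σ) ((T₂.comap (natAdd n₁)).comap (natAdd m)) ((T₁.comap (castAdd n₂)).comap (natAdd m))`

on `Fin (m + (n₁ + n₂))` (read the selector bit `σ` of the first block; on `true` run `T₁` on the middle block, on `false` run
`T₂` on the last block; written out in full below, no definition is introduced).  On a block input `y ⧺ (b ⧺ c)`:

* `eval_gated` — the output is `if y σ then T₁.eval b else T₂.eval c`;
* `castAdd_mem_queries_gated_iff` — the selector coordinate `castAdd σ'` is queried iff `σ' = σ`;
* `natAdd_castAdd_mem_queries_gated_iff` — the middle-block coordinate `i` is queried iff `y σ = true ∧ i ∈ T₁.queries b`;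
* `natAdd_natAdd_mem_queries_gated_iff` — the last-block coordinate `l` is queried iff `y σ = false ∧ l ∈ T₂.queries c`.

These are the pointwise facts from which the blockwise sums of the `6/5` certificate (`D₃ ▷ (G₂,G₂)` on `Fin (3+(4+4))`) are
assembled with `…BlockCalculus.sum_cube_append` and the block sums of `…GatedComposition`.

Honest label: elementary infrastructure; no registered stub, crux or summit is closed.  Source: H. Buhrman, R. de Wolf,
TCS 288 (2002) §2.1 (decision trees and restrictions).
-/

set_option linter.dupNamespace false

namespace Summit.QuantumAdvantage.QuantumAdvantage.Theorems.SosSandwich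

open Finset Function
open Literature.Computability.Complexity
open ClassicalCornerBlockCalculus

namespace ClassicalCornerGatedTree

variable {m n₁ n₂ : ℕ}

/-- **Output of a gated tree** on a block input: the selector bit chooses which inner tree answers. [cite: Wolf2002, §2.1] -/
theorem eval_gated (σ : Fin m) (T₁ : DecisionTree n₁) (T₂ : DecisionTree n₂)
    (y : Fin m → Bool) (b : Fin n₁ → Bool) (c : Fin n₂ → Bool) :
    (DecisionTree.query (Fin.castAdd (n₁ + n₂) σ)
        ((T₂.comap (Fin.natAdd n₁)).comap (Fin.natAdd m))
        ((T₁.comap (Fin.castAdd n₂)).comap (Fin.natAdd m))).eval (Fin.append y (Fin.append b c)) =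
      if y σ = true then T₁.eval b else T₂.eval c := by
  rw [DecisionTree.eval_query, Fin.append_left, eval_comap_natAdd_append, eval_comap_natAdd_append,
    eval_comap_castAdd_append, eval_comap_natAdd_append]

/-- **A gated tree queries exactly its own selector coordinate** among the first block. [cite: Wolf2002, §2.1] -/
theorem castAdd_mem_queries_gated_iff (σ σ' : Fin m) (T₁ : DecisionTree n₁) (T₂ : DecisionTree n₂)
    (x : Fin (m + (n₁ + n₂)) → Bool) :
    Fin.castAdd (n₁ + n₂) σ' ∈ (DecisionTree.query (Fin.castAdd (n₁ + n₂) σ)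
        ((T₂.comap (Fin.natAdd n₁)).comap (Fin.natAdd m))
        ((T₁.comap (Fin.castAdd n₂)).comap (Fin.natAdd m))).queries x ↔ σ' = σ := by
  rw [DecisionTree.queries_query, Finset.mem_insert]
  constructor
  · rintro (h | h)
    · exact Fin.castAdd_injective _ _ h
    · exfalso
      by_cases hx : x (Fin.castAdd (n₁ + n₂) σ) = true
      · rw [if_pos hx] at h
        exact castAdd_not_mem_queries_comap_natAdd _ x σ' h
      · rw [if_neg hx] at h
        exact castAdd_not_mem_queries_comap_natAdd _ x σ' h
  · rintro rfl
    exact Or.inl rfl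

/-- **Middle-block queries of a gated tree**: coordinate `i` of the middle block is read iff the selector bit is `true` and
`T₁` reads `i`. [cite: Wolf2002, §2.1] -/
theorem natAdd_castAdd_mem_queries_gated_iff (σ : Fin m) (T₁ : DecisionTree n₁) (T₂ : DecisionTree n₂)
    (y : Fin m → Bool) (b : Fin n₁ → Bool) (c : Fin n₂ → Bool) (i : Fin n₁) :
    Fin.natAdd m (Fin.castAdd n₂ i) ∈ (DecisionTree.query (Fin.castAdd (n₁ + n₂) σ)
        ((T₂.comap (Fin.natAdd n₁)).comap (Fin.natAdd m))
        ((T₁.comap (Fin.castAdd n₂)).comap (Fin.natAdd m))).queries (Fin.append y (Fin.append b c)) ↔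
      y σ = true ∧ i ∈ T₁.queries b := by
  rw [DecisionTree.queries_query, Finset.mem_insert, Fin.append_left]
  have hne : Fin.natAdd m (Fin.castAdd n₂ i) ≠ Fin.castAdd (n₁ + n₂) σ := fun h => castAdd_ne_natAdd σ _ h.symm
  by_cases hy : y σ = true
  · rw [if_pos hy, natAdd_mem_queries_comap_natAdd_iff, castAdd_mem_queries_comap_castAdd_iff]
    constructor
    · rintro (h | h)
      · exact absurd h hne
      · exact ⟨hy, h⟩
    · rintro ⟨-, h⟩
      exact Or.inr h
  · rw [if_neg hy, natAdd_mem_queries_comap_natAdd_iff]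
    constructor
    · rintro (h | h)
      · exact absurd h hne
      · exact absurd h (castAdd_not_mem_queries_comap_natAdd T₂ _ i)
    · rintro ⟨h, -⟩
      exact absurd h hy

/-- **Last-block queries of a gated tree**: coordinate `l` of the last block is read iff the selector bit is `false` and
`T₂` reads `l`. [cite: Wolf2002, §2.1] -/
theorem natAdd_natAdd_mem_queries_gated_iff (σ : Fin m) (T₁ : DecisionTree n₁) (T₂ : DecisionTree n₂)
    (y : Fin m → Bool) (b : Fin n₁ → Bool) (c : Fin n₂ → Bool) (l : Fin n₂) :
    Fin.natAdd m (Fin.natAdd n₁ l) ∈ (DecisionTree.query (Fin.castAdd (n₁ + n₂) σ)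
        ((T₂.comap (Fin.natAdd n₁)).comap (Fin.natAdd m))
        ((T₁.comap (Fin.castAdd n₂)).comap (Fin.natAdd m))).queries (Fin.append y (Fin.append b c)) ↔
      y σ = false ∧ l ∈ T₂.queries c := by
  rw [DecisionTree.queries_query, Finset.mem_insert, Fin.append_left]
  have hne : Fin.natAdd m (Fin.natAdd n₁ l) ≠ Fin.castAdd (n₁ + n₂) σ := fun h => castAdd_ne_natAdd σ _ h.symm
  by_cases hy : y σ = true
  · rw [if_pos hy, natAdd_mem_queries_comap_natAdd_iff]
    constructor
    · rintro (h | h)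
      · exact absurd h hne
      · exact absurd h (natAdd_not_mem_queries_comap_castAdd T₁ _ l)
    · rintro ⟨h, -⟩
      rw [hy] at h
      cases h
  · rw [if_neg hy, natAdd_mem_queries_comap_natAdd_iff, natAdd_mem_queries_comap_natAdd_iff]
    have hy' : y σ = false := Bool.eq_false_iff.mpr hy
    constructor
    · rintro (h | h)
      · exact absurd h hne
      · exact ⟨hy', h⟩
    · rintro ⟨-, h⟩
      exact Or.inr h

end ClassicalCornerGatedTree

end Summit.QuantumAdvantage.QuantumAdvantage.Theorems.SosSandwich
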